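import Mathlib
import HarnessLib
import HarnessLib.Audit
import Summits.NavierStokesRegularity.Statement
import Literature.Analysis.FluidPDE.ClassicalSolution
import Literature.Analysis.FluidPDE.LerayHopf
import Literature.Analysis.FluidPDE.VectorCalculus
import Literature.Analysis.FluidPDE.Vorticity
import Literature.Analysis.FluidPDE.NSVorticity
import Summits.NavierStokesRegularity.NavierStokesRegularity.Theorems.VorticityGeometryAssembly
import Summits.NavierStokesRegularity.NavierStokesRegularity.Theorems.TypeICertificateLadderNoBlowupToClay
import Literature.Analysis.FluidPDE.NSLerayHopf
import Literature.Analysis.FluidPDE.TaoLocalisation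

/-!
Route: VorticityGeometry

CLOSED (superseded) 2026-08-15T16:12:04Z by planner-rbadge-NavierStokesRegularity-Vorticit-cb9aac86-g2-0 — reason: superseded:route-NavierStokesRegularity-DirectionDissipationQuantum — superseded by route-NavierStokesRegularity-DirectionDissipationQuantum — note: route-repair (rbadge g2, 2026-08-15): CLOSED AS SUPERSEDED by route-NavierStokesRegularity-DirectionDissipationQuantum. Census. (1) Defects on entry: crux-floor 1<2, 3 assembly items, glue.missing, 2 cite-only cone facts (constantin_fefferman via item 0093; linfty_bound_of_hasBoundedSobolevNormsOn v. The file is kept as the record of this route; refuted decls are indexed as negative knowledge (`ledger negatives`).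

# Route VorticityGeometry — NavierStokesRegularity (Clay A), positive side (geometric)

## Thesis X (a-priori Constantin–Fefferman coherence)
In words: for every ν>0 and every finite-energy classical solution on ℝ³×[0,T) from a rapidly
decaying datum there
are Ω, ρ > 0 such that in the region {|ω| > Ω} the vorticity direction ξ = ω/|ω| is
Lipschitz-coherent uniformly up
to T: |sin∠(ξ(x,t), ξ(y,t))| ≤ |x−y|/ρ.
Lean (elaborates):
  ∀ (ν T : ℝ), 0<ν → 0<T → ∀ u p, Literature.Analysis.FluidPDE.IsClassicalNSSolutionOn (Set.Ico 0 T)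
ν 0 u p → Literature.Analysis.FluidPDE.IsLerayHopfOn T ν 0 (u 0) u →
   Literature.Analysis.FluidPDE.HasRapidSpatialDecay (u 0) → ∃ Ω ρ : ℝ, 0<Ω ∧ 0<ρ ∧ ∀ t ∈ Set.Ico 0
T, ∀ x y, Ω < ‖Literature.Analysis.FluidPDE.curl (u t) x‖ →
   Ω < ‖Literature.Analysis.FluidPDE.curl (u t) y‖ → Real.sqrt (1 - (inner ℝ
(Literature.Analysis.FluidPDE.vorticityDirection (Literature.Analysis.FluidPDE.curl (u t)) x)
   (Literature.Analysis.FluidPDE.vorticityDirection (Literature.Analysis.FluidPDE.curl (u t)) y)) ^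
2) ≤ ‖x - y‖ / ρ

## Assembly X → NavierStokesRegularity
X + `Literature.Analysis.FluidPDE.constantin_fefferman` (ConstantinFefferman1993 Thm; decl exists,
expected Literature fact) + BKM-class
persistence of Schwartz regularity before T (crux #4) ⇒ HasSobolevExtensionPast ⇒
HasSmoothExtensionPast, i.e.
NoBlowup (stmt-…-0054) ⇒ A (stmt-…-0055, shared assembly).

## Why this line
Vortex stretching ω·∇u is the only supercritical mechanism; Constantin's identity writes the
stretching rate as a
singular integral whose kernel vanishes when neighbouring vorticity directions are parallel
(geometric depletion,
ConstantinFefferman1993; BealeKatoMajda1984 for the continuation criterion it feeds). The route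
imports geometric
measure of alignment (differential geometry of the direction field) instead of size. Evidence:
numerically observed
blow-up candidates flatten into anti-parallel sheet/tube pairs where ξ develops kinks (Hou-type
scenarios,
ChenHou2022 for Euler), so X is exactly the statement such scenarios must violate — informative on
both sides.
Known: Lipschitz coherence suffices (CF 1993); ½-Hölder suffices (Beirão da Veiga–Berselli 2002, not
in bib);
no a-priori coherence result of any modulus is known for large data.

## Ranked cruxes
#2 X itself as an a-priori estimate (rank 2; hardest). Its negation ¬X is filed too (rank 5): a
finite-energy
   smooth solution, possibly GLOBAL and regular, whose direction field is not uniformly Lipschitz in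
{|ω|>Ω} for
   any Ω, ρ — this would kill the route WITHOUT settling A, hence cheap and decisive for a refuter.
#3 `Literature.Analysis.FluidPDE.constantin_fefferman` (fact; ConstantinFefferman1993).
#4 BKM-class persistence: finite-energy classical solutions from Clay data have all Sobolev norms
bounded on every
   compact [0,T''] ⊂ [0,T) (`Literature.Analysis.FluidPDE.HasBoundedSobolevNormsOn`; Schwartz
persistence, standard; expected fact).
#5 ¬X (see #2).

## Kill criteria
¬X proved (even by a regular example); or blow-up (routes Blowup/CertifiedBlowup).
Pivot available: replace Lipschitz by ½-Hölder modulus (weaker X, same assembly with the Beirão da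
Veiga–Berselli
theorem as a new cite item) — only if ¬X is proved specifically at the Lipschitz level.

## NOT decomposed
The evolution equation for ξ and any maximum-principle/energy method for it; localisation (only
high-|ω| regions
near a putative singular point matter, CKN1982); axisymmetric test cases.

UNDER FLOOR: fewer than 2 cruxes remain after retriage (legacy route; D-0019).

Rationale: Geometric depletion: a-priori Constantin–Fefferman direction coherence closes via the CF theorem; ¬X
filed as a cheap decisive refuter target.

Novelty: NOVELTY (retriage 2026-08-14; searched before claiming: `lit search` / `lit search --hybrid` / `lit
vsearch` on
"vorticity direction coherence a priori Navier-Stokes", `lit frontier NavierStokesRegularity --since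
2020`,
`lit bridges NavierStokesRegularity --cross any`, crossref author sweep Beirão da Veiga / Berselli /
Grujić).
Nearest prior art — every printed result is a CONDITIONAL criterion, none an a-priori estimate:
(1) ConstantinFefferman1993 (Indiana Univ. Math. J. 42, Thm of §1; in-tree fact
Literature.Analysis.FluidPDE.constantin_fefferman):
Lipschitz sine-coherence of ξ = ω⁄|ω| in {|ω| > Ω} for a smooth finite-energy solution on [0,T) ⇒
continuation
past T — this is exactly X ⇒ NoBlowup, the route's assembly, not X. (2) Beirão da Veiga–Berselli
2002
(doi:10.57262/die/1356060864): ½-Hölder coherence suffices; localised and made scaling-invariant in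
Grujić 2009
(doi:10.1007/s00220-008-0726-8) and Grujić–Guberović 2010 (doi:10.1007/s00220-010-1000-4, hybrid
criterion
∫∫ |ω|² ρ²_{½,2R} < ∞); Berselli 2023 (doi:10.1088/1361-6544/ace096, Thm 1.1: smallness of the angle
at six
grid points) — all conditional; the surveys arXiv:1604.08083 and doi:10.3934/dcdss.2019014 list β <
½ and any
unconditional statement as open. (3) The ONLY unconditional direction-regularity known for large
data is
Constantin 1990 (CMP 129, 241–266), restated in
book:cannone2006-mathematical-foundation-turbulent-viscous-flows
p.47 and arXiv:1205.7080 p.3: ∫₀ᵀ∫ |ω| |∇ξ|² dx dt ≤ ½ ν⁻² ‖u₀‖²_{L²} — a  [refs: 10.57262/die/1356060864, 10.1007/s00220-008-0726-8, 10.1007/s00220-010-1000-4, 10.1088/1361-6544/ace096, 10.3934/dcdss.2019014, 1604.08083, 1205.7080, 1704.05546, 2107.06509, doi:10.57262/die/1356060864, doi:10.1007/s00220-008-0726-8, doi:10.1007/s00220-010-1000-4, doi:10.1088/1361-6544/ace096, doi:10.3934/dcdss.2019014, book:cannone2006-mathematical-foundation-turbulent-viscous-flows, ConstantinF]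

Barriers (technique_class: vorticity-direction-coherence supercritical-a-priori-control): BARRIERS (retriage 2026-08-14; catalogue lean/Literature/Barriers/NavierStokesRegularity, 18 files
read).
technique_class: vorticity-direction-coherence supercritical-a-priori-control
- Literature.Barriers.NavierStokesRegularity.EnergySupercriticality : APPLIES squarely. X is a
pointwise (L^∞) bound
  on ∇ξ in {|ω| > Ω}; the only a-priori controlled direction quantity, Constantin 1990's ∫∫ |ω||∇ξ|²
≤ ½ν⁻²‖u₀‖²
  (book:cannone2006-mathematical-foundation-turbulent-viscous-flows p.47), scales like the kinetic
energy (λ⁻¹ under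
  u ↦ λu(λ²t, λx)), so "energy-class bounds + scale-respecting estimates" cannot reach X (same gap
as L^∞L² vs L^∞L³).
  NOT evaded: the bet is that ξ obeys its own parabolic system (Constantin's diffusive
Cauchy-invariant form, same book
  p.48 eq. (4.13)) carrying a maximum-principle-type coercive quantity invisible to energy methods —
none is in hand,
  and the route files no crux naming one.
- Literature.Barriers.NavierStokesRegularity.TaoAveragedBlowup : APPLIES to any proof of X that
treats the bilinear
  term abstractly (energy identity + harmonic-analysis estimates; Tao2016AveragedNS =
arXiv:1402.0290 Thm 1.5, pp. 5–8).
  Evasion is available only in form: geometric depletion rests on the exact algebraic structure of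
the Biot–Savart
  kernel (the stretching rate α(x) = P.V.∫ D(ŷ, ξ(x+y), ξ(x)) |ω(x+y)| |y|⁻³ dy vanishes on aligned
directions,
  ConstantinFefferman1993 §1), a property Tao's averaged operators B̃ need not share — "finer
structure of

History (route lifecycle, newest last):
- 2026-08-15T16:12:06Z · CLOSED superseded — superseded:route-NavierStokesRegularity-DirectionDissipationQuantum (planner-rbadge-NavierStokesRegularity-Vorticit-cb9aac86-g2-0)

sub-problem: NavierStokesRegularity · status: closed(superseded) · opened planner-NavierStokesRegularity-Survey-0 2026-08-13T06:05:11Z · rev 2 · ledger route-NavierStokesRegularity-VorticityGeometry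
GENERATED by the gate from the ledger (D-0016/17). Provers cite these decls: `theorem foo : Summit.NavierStokesRegularity.NavierStokesRegularity.Theses.VorticityGeometry.<Decl> := …` in Summits/NavierStokesRegularity/NavierStokesRegularity/Theorems/<Name>.lean.
-/

namespace Summit.NavierStokesRegularity.NavierStokesRegularity.Theses.VorticityGeometry

open scoped BigOperators Topology Manifold Classical MeasureTheory ProbabilityTheory Matrix InnerProductSpace ComplexConjugate ContinuousMap
open Filter Set Function TopologicalSpace MeasureTheory

attribute [summit_statement] _root_.NavierStokesRegularity

open Literature.NS

/-- item stmt-NavierStokesRegularity-0091 · crux · rank 0 · closed · moot by None · by planner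
why it might fail: As typed (∃Ω,ρ after ∀u) X is vacuous when sup|ω|<∞, so X ⇔ NoBlowup mod CF93+Tao2011 facts (grounder-B, g2-6): (A)-hard; false iff a Schwartz datum blows up (Hou2022 numerics). Only a-priori direction control: Co90 ∫∫|ω||∇ξ|² ≤ ‖u₀‖²⁄2ν², energy scaling; pointwise coherence is supercritical (DG12).
sources: ConstantinFefferman1993 (Indiana Univ. Math. J. 42 (1993), Thm of §1) = in-tree fact Literature.Analysis.FluidPDE.constantin_fefferman (NSVorticity.lean:186), arXiv:1205.7080 p.3 (Dascaliuc–Grujić 2012): CF93, BdVB02, Gr09, GrGu10 criteria are pointwise hence supercritical; the a-priori bound is Constantin 1990 (CMP 129) ∫∫|ω||∇ξ|² ≤ ½ν⁻²‖u₀‖², book:cannone2006-mathematical-foundation-turbulent-viscous-flows p.47 (Constantin CIME lectures §4): the same a-priori space-time bound, refs [16]=Constantin 1990, [21], doi:10.57262/die/1356060864 (Beirão da Veiga–Berselli 2002, DIE 15): ½-Hölder coherence suffices — still conditional, arXiv:1604.08083 (Beirão da Veiga 2016): Hölder exponents β<½ listed as OPEN; no a-priori coherence result, doi:10.1088/1361-6544/ace096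 (Berselli 2023, Nonlinearity 36): newest direction criterion (six grid points), still conditional
For every ν>0 and finite-energy classical solution on ℝ³×[0,T) from a rapidly decaying datum, ∃
Ω,ρ>0: in {|ω|>Ω} the vorticity direction satisfies |sin∠(ξ(x,t),ξ(y,t))| ≤ |x−y|/ρ for all t<T (the
hypothesis of Constantin–Fefferman 1993, as an a-priori estimate). [sources:
ConstantinFefferman1993, BealeKatoMajda1984, MajdaBertozzi2002] -/
@[route_item "route-NavierStokesRegularity-VorticityGeometry"]
def VorticityGeometryThesis : Prop :=
  ∀ (ν T : ℝ), 0 < ν → 0 < T → ∀ (u : ℝ → EuclideanSpace ℝ (Fin 3) → EuclideanSpace ℝ (Fin 3)) (p : ℝ → EuclideanSpace ℝ (Fin 3) → ℝ), Literature.Analysis.FluidPDE.IsClassicalNSSolutionOn (Set.Ico 0 T) ν 0 u p → Literature.Analysis.FluidPDE.IsLerayHopfOn T ν 0 (u 0) u → Literature.Analysis.FluidPDE.HasRapidSpatialDecay (u 0) → ∃ Ω ρ : ℝ, 0 < Ω ∧ 0 < ρ ∧ ∀ t ∈ Set.Ico 0 T, ∀ x y : EuclideanSpace ℝ (Fin 3),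 Ω < ‖Literature.Analysis.FluidPDE.curl (u t) x‖ → Ω < ‖Literature.Analysis.FluidPDE.curl (u t) y‖ → Real.sqrt (1 - (inner ℝ (Literature.Analysis.FluidPDE.vorticityDirection (Literature.Analysis.FluidPDE.curl (u t)) x) (Literature.Analysis.FluidPDE.vorticityDirection (Literature.Analysis.FluidPDE.curl (u t)) y)) ^ 2) ≤ ‖x - y‖ / ρ

/-- item stmt-NavierStokesRegularity-0093 · support · rank 3 · closed · moot by None · by planner
Constantin–Fefferman, Indiana Univ. Math. J. 42 (1993), Theorem: Lipschitz coherence of the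
vorticity direction in {|ω|>Ω} for a finite-energy classical solution in the BKM class on [0,T)
implies continuation past T. Decl exists in Literature/Analysis/FluidPDE/NSVorticity.lean; expected
to be grounded as a named fact. [sources: ConstantinFefferman1993] -/
@[route_item "route-NavierStokesRegularity-VorticityGeometry"]
def VorticityGeometryCF : Prop :=
  Literature.Analysis.FluidPDE.constantin_fefferman

/-- item stmt-NavierStokesRegularity-0094 · support · rank 4 · closed · moot by None · by planner
A finite-energy classical solution on [0,T) from a rapidly decaying smooth datum has, for every
T''<T and every n, sup_{t≤T''} ‖Dⁿu(t)‖_{L²} < ∞ (propagation of H^s regularity / Schwartz decay on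
compact sub-intervals; Leray 1934, Kato; Majda–Bertozzi 2002 §3.2). Needed to feed
constantin_fefferman and beale_kato_majda. Caveat for the grounder: a classical solution in H21's
sense is only C^∞ jointly, not a priori H^s-bounded in x; the Leray–Hopf clause plus weak–strong
uniqueness identifies it with the H^s solution. [sources: MajdaBertozzi2002, BealeKatoMajda1984,
Kato1984, Leray1934] -/
@[route_item "route-NavierStokesRegularity-VorticityGeometry"]
def VorticityGeometryBkmPersistence : Prop :=
  ∀ (ν T : ℝ), 0 < ν → 0 < T → ∀ (u : ℝ → EuclideanSpace ℝ (Fin 3) → EuclideanSpace ℝ (Fin 3)) (p : ℝ → EuclideanSpace ℝ (Fin 3) → ℝ), Literature.Analysis.FluidPDE.IsClassicalNSSolutionOn (Set.Ico 0 T) ν 0 u p → Literature.Analysis.FluidPDE.IsLerayHopfOn T ν 0 (u 0) u → Literature.Analysis.FluidPDE.HasRapidSpatialDecay (u 0) → ∀ T'' < T, Literature.Analysis.FluidPDE.HasBoundedSobolevNormsOn (Set.Icc 0 T'') u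

/-- item stmt-NavierStokesRegularity-0732 · support · rank 4 · closed · moot by None · by planner
Formal glue (~15 lines) making crux #4 = stmt-NavierStokesRegularity-0094 (BKM-class persistence,
premise 2 of Literature.NS.vorticityGeometry_assembly) close the moment the named fact of cite item
wi-04767 (Literature.NS.tao_smooth_finite_energy_sobolev_bounds; Tao2011 Cor 11.1 + Cor 4.3 + Thm
5.4(iii),(iv): on a CLOSED slab [0,T] a smooth finite-energy NS solution with Schwartz datum has all
H^k norms bounded) is vendored with the tested shape used here as hypothesis: given T″ < T set T₁ :=
max T″ (T/2) ∈ (0,T); restrict Ico 0 T → Icc 0 T₁ (IsClassicalNSSolutionOn.mono, uniqueDiffOn_Icc);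
sup_{[0,T₁]}∫|u t|² < ∞ from IsLerayHopfOn.energy_ineq_zero (f=0) + memLp + eEnergy_eq_ofReal; apply
the hypothesis; HasBoundedSobolevNormsOn.mono to Icc 0 T″ (empty if T″<0). This replaces the
paywalled CKN1982 Thm C/D far-field route (acq-00031) flagged by grounder-B/g6-*. Provable NOW
(hypothesis form). [sources: Tao2011, BealeKatoMajda1984, Leray1934] -/
@[route_item "route-NavierStokesRegularity-VorticityGeometry"]
def VorticityGeometryPersistenceOfTaoSobolevBounds : Prop :=
  (∀ (ν T : ℝ), 0 < ν → 0 < T → ∀ (u : ℝ → EuclideanSpace ℝ (Fin 3) → EuclideanSpace ℝ (Fin 3)) (p : ℝ → EuclideanSpace ℝ (Fin 3) → ℝ), Literature.Analysis.FluidPDE.IsClassicalNSSolutionOn (Set.Icc 0 T) ν 0 u p → (∃ C : ENNReal, C < ⊤ ∧ ∀ t ∈ Set.Icc 0 T, ∫⁻ x, ‖u t x‖ₑ ^ 2 ≤ C) → Literature.Analysis.FluidPDE.HasRapidSpatialDecay (u 0) → Literature.Analysis.FluidPDE.HasBoundedSobolevNormsOn (Set.Icc 0 T) u ∧ Literature.Analysis.FluidPDE.MemLqLp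 ⊤ ⊤ u (Set.Ioo 0 T)) → (∀ (ν T : ℝ), 0 < ν → 0 < T → ∀ (u : ℝ → EuclideanSpace ℝ (Fin 3) → EuclideanSpace ℝ (Fin 3)) (p : ℝ → EuclideanSpace ℝ (Fin 3) → ℝ), Literature.Analysis.FluidPDE.IsClassicalNSSolutionOn (Set.Ico 0 T) ν 0 u p → Literature.Analysis.FluidPDE.IsLerayHopfOn T ν 0 (u 0) u → Literature.Analysis.FluidPDE.HasRapidSpatialDecay (u 0) → ∀ T'' < T, Literature.Analysis.FluidPDE.HasBoundedSobolevNormsOn (Set.Icc 0 T'') u)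

/-- item stmt-NavierStokesRegularity-0095 · support · rank 5 · closed · moot by None · by planner
Refuter target that kills the route without settling Clay A: exhibit ν, T and a finite-energy
classical solution from a rapidly decaying datum (it may well be globally regular) such that for
every Ω,ρ>0 the CF sine-Lipschitz bound fails somewhere in {|ω|>Ω}×[0,T). E.g. vortex reconnection
of anti-parallel tubes at high Reynolds number, or data with a smooth but non-Lipschitz direction
field where |ω| is large. [sources: ConstantinFefferman1993, ChenHou2022] -/
@[route_item "route-NavierStokesRegularity-VorticityGeometry"]
def VorticityGeometryNotApriori : Prop :=
  ¬ (∀ (ν T : ℝ), 0 < ν → 0 < T → ∀ (u : ℝ → EuclideanSpace ℝ (Fin 3) → EuclideanSpace ℝ (Fin 3)) (p : ℝ → EuclideanSpace ℝ (Fin 3) → ℝ), Literature.Analysis.FluidPDE.IsClassicalNSSolutionOn (Set.Ico 0 T) ν 0 u p → Literature.Analysis.FluidPDE.IsLerayHopfOn T ν 0 (u 0) u → Literature.Analysis.FluidPDE.HasRapidSpatialDecay (u 0) → ∃ Ω ρ : ℝ, 0 < Ω ∧ 0 < ρ ∧ ∀ t ∈ Set.Ico 0 T, ∀ x y : EuclideanSpace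 ℝ (Fin 3), Ω < ‖Literature.Analysis.FluidPDE.curl (u t) x‖ → Ω < ‖Literature.Analysis.FluidPDE.curl (u t) y‖ → Real.sqrt (1 - (inner ℝ (Literature.Analysis.FluidPDE.vorticityDirection (Literature.Analysis.FluidPDE.curl (u t)) x) (Literature.Analysis.FluidPDE.vorticityDirection (Literature.Analysis.FluidPDE.curl (u t)) y)) ^ 2) ≤ ‖x - y‖ / ρ)

/-- item stmt-NavierStokesRegularity-0055 · assembly · rank 1 · closed · proved by Summit.NavierStokesRegularity.NavierStokesRegularity.Theorems.typeICertificateLadder_noBlowupToClay_proof @ f501e9774e4d (prover) · by planner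
Given NoBlowup, build the Clay (A) solution: local finite-energy classical solution for smooth
divergence-free rapidly decaying data (Leray 1934 §III / Fujita–Kato 1964 + LPS smoothing), continue
past every T using NoBlowup, glue by weak–strong uniqueness (Prodi–Serrin), bounded energy from the
energy inequality, and convert with
Literature.Analysis.FluidPDE.isNavierStokesSolution_and_smooth_iff. Blow-up at spatial infinity is
excluded by CKN ε-regularity applied far out. May take named Literature facts (leray_existence_R3,
ladyzhenskaya_prodi_serrin, weak_strong_uniqueness, fujita_kato_local) as hypotheses if the grounder
so rules. -/
@[route_item "route-NavierStokesRegularity-VorticityGeometry"]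
def Assembly : Prop :=
  (∀ (ν T : ℝ), 0 < ν → 0 < T → ∀ (u : ℝ → EuclideanSpace ℝ (Fin 3) → EuclideanSpace ℝ (Fin 3)) (p : ℝ → EuclideanSpace ℝ (Fin 3) → ℝ), Literature.Analysis.FluidPDE.IsClassicalNSSolutionOn (Set.Ico 0 T) ν 0 u p → Literature.Analysis.FluidPDE.IsLerayHopfOn T ν 0 (u 0) u → Literature.Analysis.FluidPDE.HasRapidSpatialDecay (u 0) → Literature.Analysis.FluidPDE.HasSmoothExtensionPast ν 0 u T) → NavierStokesRegularity

/-- `Assembly` holds: proved by `Summit.NavierStokesRegularity.NavierStokesRegularity.Theorems.typeICertificateLadder_noBlowupToClay_proof` @ f501e9774e4d. -/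
theorem Assembly_holds : Assembly := _root_.Summit.NavierStokesRegularity.NavierStokesRegularity.Theorems.typeICertificateLadder_noBlowupToClay_proof

/-- item stmt-NavierStokesRegularity-0092 · assembly · rank 1 · closed · proved by Literature.NS.vorticityGeometry_assembly (refuter) · by planner
Combine X with the Constantin–Fefferman theorem (Literature.Analysis.FluidPDE.constantin_fefferman,
crux #3) and BKM-class persistence (crux #4) to get HasSobolevExtensionPast, hence
HasSmoothExtensionPast
(Literature.Analysis.FluidPDE.HasSobolevExtensionPast.hasSmoothExtensionPast). May take (h₃ :
Literature.Analysis.FluidPDE.constantin_fefferman) and crux #4 as hypotheses if grounded as facts.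
Final step to A is the shared item stmt-NavierStokesRegularity-0055. [sources:
ConstantinFefferman1993, BealeKatoMajda1984] -/
@[route_item "route-NavierStokesRegularity-VorticityGeometry"]
def Assembly2 : Prop :=
  Literature.Analysis.FluidPDE.constantin_fefferman → (∀ (ν T : ℝ), 0 < ν → 0 < T → ∀ (u : ℝ → EuclideanSpace ℝ (Fin 3) → EuclideanSpace ℝ (Fin 3)) (p : ℝ → EuclideanSpace ℝ (Fin 3) → ℝ), Literature.Analysis.FluidPDE.IsClassicalNSSolutionOn (Set.Ico 0 T) ν 0 u p → Literature.Analysis.FluidPDE.IsLerayHopfOn T ν 0 (u 0) u → Literature.Analysis.FluidPDE.HasRapidSpatialDecay (u 0) → ∀ T'' < T, Literature.Analysis.FluidPDE.HasBoundedSobolevNormsOn (Set.Icc 0 T'') u) → (∀ (ν T : ℝ), 0 < ν → 0 < T → ∀ (u : ℝ → EuclideanSpace ℝ (Fin 3) → EuclideanSpace ℝ (Fin 3)) (p : ℝ → EuclideanSpace ℝ (Fin 3) → ℝ), Literature.Analysis.FluidPDE.IsClassicalNSSolutionOn (Set.Ico 0 T) ν 0 u p → Literature.Analysis.FluidPDE.IsLerayHopfOn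 T ν 0 (u 0) u → Literature.Analysis.FluidPDE.HasRapidSpatialDecay (u 0) → ∃ Ω ρ : ℝ, 0 < Ω ∧ 0 < ρ ∧ ∀ t ∈ Set.Ico 0 T, ∀ x y : EuclideanSpace ℝ (Fin 3), Ω < ‖Literature.Analysis.FluidPDE.curl (u t) x‖ → Ω < ‖Literature.Analysis.FluidPDE.curl (u t) y‖ → Real.sqrt (1 - (inner ℝ (Literature.Analysis.FluidPDE.vorticityDirection (Literature.Analysis.FluidPDE.curl (u t)) x) (Literature.Analysis.FluidPDE.vorticityDirection (Literature.Analysis.FluidPDE.curl (u t)) y)) ^ 2) ≤ ‖x - y‖ / ρ) → ∀ (ν T : ℝ), 0 < ν → 0 < T → ∀ (u : ℝ → EuclideanSpace ℝ (Fin 3) → EuclideanSpace ℝ (Fin 3)) (p : ℝ → EuclideanSpace ℝ (Fin 3) → ℝ), Literature.Analysis.FluidPDE.IsClassicalNSSolutionOn (Set.Ico 0 T) ν 0 u p → Literature.Analysis.FluidPDE.IsLerayHopfOn T ν 0 (u 0) u → Literature.Analysis.FluidPDE.HasRapidSpatialDecay (u 0) → Literature.Analysis.FluidPDE.HasSmoothExtensionPast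 ν 0 u T

/-- `Assembly2` holds: proved by `Literature.NS.vorticityGeometry_assembly`. -/
theorem Assembly2_holds : Assembly2 := _root_.Literature.NS.vorticityGeometry_assembly

/-- item stmt-NavierStokesRegularity-0762 · assembly · rank 1 · closed · moot by None · by planner
[assembly] CF fact → Tao2011 closed-slab Sobolev bounds → Sobolev embedding H² ⊂ L^∞ → X (Coherence)
→ (NoBlowup → A, shared stmt-NavierStokesRegularity-0055) → NavierStokesRegularity. Glue only (~20
lines): NoBlowup from Literature.NS.vorticityGeometry_assembly hCF
(Literature.NS.vorticityGeometry_persistence_of_tao_sobolev_bounds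
(tao2011_hasBoundedSobolevNormsOn.closedSlab h₁ h₂)) hX, then apply the last hypothesis. [sources:
ConstantinFefferman1993, Tao2011, AdamsFournier2003, BealeKatoMajda1984] -/
@[route_item "route-NavierStokesRegularity-VorticityGeometry"]
def Assembly3 : Prop :=
  Literature.Analysis.FluidPDE.constantin_fefferman → Literature.Analysis.FluidPDE.tao2011_hasBoundedSobolevNormsOn → Literature.Analysis.FluidPDE.linfty_bound_of_hasBoundedSobolevNormsOn → (∀ (ν T : ℝ), 0 < ν → 0 < T → ∀ (u : ℝ → EuclideanSpace ℝ (Fin 3) → EuclideanSpace ℝ (Fin 3)) (p : ℝ → EuclideanSpace ℝ (Fin 3) → ℝ), Literature.Analysis.FluidPDE.IsClassicalNSSolutionOn (Set.Ico 0 T) ν 0 u p → Literature.Analysis.FluidPDE.IsLerayHopfOn T ν 0 (u 0) u → Literature.Analysis.FluidPDE.HasRapidSpatialDecay (u 0) → ∃ Ω ρ : ℝ, 0 < Ω ∧ 0 < ρ ∧ ∀ t ∈ Set.Ico 0 T, ∀ x y : EuclideanSpace ℝ (Fin 3), Ω < ‖Literature.Analysis.FluidPDE.curl (u t) x‖ →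 Ω < ‖Literature.Analysis.FluidPDE.curl (u t) y‖ → Real.sqrt (1 - (inner ℝ (Literature.Analysis.FluidPDE.vorticityDirection (Literature.Analysis.FluidPDE.curl (u t)) x) (Literature.Analysis.FluidPDE.vorticityDirection (Literature.Analysis.FluidPDE.curl (u t)) y)) ^ 2) ≤ ‖x - y‖ / ρ) → ((∀ (ν T : ℝ), 0 < ν → 0 < T → ∀ (u : ℝ → EuclideanSpace ℝ (Fin 3) → EuclideanSpace ℝ (Fin 3)) (p : ℝ → EuclideanSpace ℝ (Fin 3) → ℝ), Literature.Analysis.FluidPDE.IsClassicalNSSolutionOn (Set.Ico 0 T) ν 0 u p → Literature.Analysis.FluidPDE.IsLerayHopfOn T ν 0 (u 0) u → Literature.Analysis.FluidPDE.HasRapidSpatialDecay (u 0) → Literature.Analysis.FluidPDE.HasSmoothExtensionPast ν 0 u T) → NavierStokesRegularity) → NavierStokesRegularity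

end Summit.NavierStokesRegularity.NavierStokesRegularity.Theses.VorticityGeometry
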